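import Mathlib
import Summits.ValiantsHypothesis.ValiantsHypothesis.Theorems.RigidityForcesSymmetryRankRigidMinimalReprLaplaceFourDefs
import Summits.ValiantsHypothesis.ValiantsHypothesis.Theorems.RigidityForcesSymmetryRankRigidMinimalReprLaplaceFourContraction
import Summits.ValiantsHypothesis.ValiantsHypothesis.Theorems.RigidityForcesSymmetryRankRigidMinimalReprLaplaceFourLineCore
import Summits.ValiantsHypothesis.ValiantsHypothesis.Theorems.RigidityForcesSymmetryRankRigidMinimalReprLaplaceFourLineE3
import Summits.ValiantsHypothesis.ValiantsHypothesis.Theorems.RigidityForcesSymmetryRankRigidMinimalReprLaplaceFourE3Dichotomy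

/-!
# The border profile `slice + (2,1,1)` of `LaplaceOptimal 4`: the planar core
# (crux `RankRigidMinimalRepr`, stmt-ValiantsHypothesis-18034, route `RigidityForcesSymmetry`)

Preparations for `profile_211s` (file `…LaplaceFourProfile211s.lean`): the profile
`f(v₀)H(v₁,v₂,v₃) + Σ_{t<2} g_t(v₀,v₁)h_t(v₂,v₃) + b(v₀,v₂)b′(v₁,v₃) + c(v₀,v₃)c′(v₁,v₂)` (Laplace weight `22 < 24`).

* `e3_dichotomy_id`: the dichotomy `e3_dichotomy` together with the vanishing of the relabelled noise along the matching
  line `ψ = (φ₀, -φ₁, 0, 0)` (needed to locate the support of the slice factor `f`).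
* `three_dep`: three matrices in a subspace of dimension `≤ 2` are linearly dependent.
* `planar_core`: the computational heart.  In the normal form with `f₀ = f₁ = 0`, the matrices
  `M = D(e₀,e₁)` and `V_w = f₃ D′(e₂,e_w) - f₂ D′(e₃,e_w)` (`w < 4`), where `D′ = Q - (Bψ)(B′φ)ᵀ - (C′φ)(Cψ)ᵀ`, all lie
  in the span of the two matrices `h₀, h₁`; written out (`U = f₃ b₂ - f₂ b₃`, `U′ = f₃ c₂ - f₂ c₃` the mixed rows) they
  are the five explicit matrices below, and five such matrices in a plane force `f₂ = f₃ = 0`.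

HONEST FRAMING: finite linear algebra toward `LaplaceOptimal 4` (rung `TiedTorusBound 3`); the crux stays OPEN; nothing
here bears on `VP ≠ VNP`.
-/

set_option autoImplicit false

-- the mandated summit-side namespace repeats a component by design (single-problem summit)
set_option linter.dupNamespace false

namespace Summit.ValiantsHypothesis.ValiantsHypothesis.Theorems.RigidityForcesSymmetryRankRigidMinimalRepr

namespace LaplaceFourLine

open Module Matrix LaplaceFourContraction

/-! ### §1 The dichotomy with the noise identity -/

/-- `e3_dichotomy` together with the vanishing of the relabelled noise along the matching line `(φ₀,-φ₁,0,0)`. -/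
theorem e3_dichotomy_id {ι : Type*} (N : Finset ι) (Xn : ι → (Fin 4 → Fin 4) → ℂ) (Sn : ι → Finset (Fin 4))
    (hXn : ∀ t ∈ N, IsSplitTerm (Sn t) (Xn t)) (hSn : ∀ t ∈ N, Sn t = {0} ∨ Sn t = {0, 1}) (hN : N.card ≤ 3)
    (b b' c c' : Fin 4 → Fin 4 → ℂ)
    (hsum : ∀ v, permPattern₄ v = (∑ t ∈ N, Xn t v) + b (v 0) (v 2) * b' (v 1) (v 3) + c (v 0) (v 3) * c' (v 1) (v 2)) :
    ∃ π : Equiv.Perm (Fin 4), let B := fun x z => b (π x) (π z); let B' := fun y w => b' (π y) (π w);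
      let C := fun x w => c (π x) (π w); let C' := fun y z => c' (π y) (π z);
    ((B 0 0 = 0 ∧ B 1 1 = 0 ∧ B 1 0 = B 0 1 ∧ B 0 2 = 0 ∧ B 0 3 = 0 ∧ B 1 2 = 0 ∧ B 1 3 = 0) ∧
    (C 0 0 = 0 ∧ C 1 1 = 0 ∧ C 1 0 = C 0 1 ∧ C 0 2 = 0 ∧ C 0 3 = 0 ∧ C 1 2 = 0 ∧ C 1 3 = 0) ∧
    (B' 0 0 = 0 ∧ B' 1 1 = 0 ∧ B' 0 1 = -B' 1 0 ∧ B' 2 0 = 0 ∧ B' 3 0 = 0 ∧ B' 2 1 = 0 ∧ B' 3 1 = 0 ∧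
      B' 0 2 = 0 ∧ B' 1 2 = 0 ∧ B' 2 2 = 0 ∧ B' 0 3 = 0 ∧ B' 1 3 = 0 ∧ B' 3 3 = 0 ∧ B' 3 2 = B' 2 3) ∧
    (C' 0 0 = 0 ∧ C' 1 1 = 0 ∧ C' 0 1 = -C' 1 0 ∧ C' 2 0 = 0 ∧ C' 3 0 = 0 ∧ C' 2 1 = 0 ∧ C' 3 1 = 0 ∧
      C' 0 2 = 0 ∧ C' 1 2 = 0 ∧ C' 2 2 = 0 ∧ C' 0 3 = 0 ∧ C' 1 3 = 0 ∧ C' 3 3 = 0 ∧ C' 3 2 = C' 2 3) ∧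
    (B 0 1 * B' 2 3 = 1 ∧ C 0 1 * C' 2 3 = 1 ∧ B 0 1 * B' 1 0 + C 0 1 * C' 1 0 = 0)) ∧
    ∀ φ : Fin 4 → ℂ, ∑ t ∈ N, contract₀₁ (letterPerm π (Xn t)) (lineVec (Sum.inr (0, 1)) φ) φ = 0 := by
  classical
  obtain ⟨d, hdvalid, hid, -⟩ := e3_core N Xn Sn hXn hSn hN b b' c c' hsum
  have key : ∀ (π : Equiv.Perm (Fin 4)) (d₀ : Fin 4 ⊕ (Fin 4 × Fin 4)), permDescr π d₀ = d →
      ∀ φ : Fin 4 → ℂ, contract₀₁ permPattern₄ (lineVec d₀ φ) φ =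
        vecMulVec (fun i => ∑ x, lineVec d₀ φ x * b (π x) (π i)) (fun j => ∑ y, φ y * b' (π y) (π j)) +
        vecMulVec (fun i => ∑ y, φ y * c' (π y) (π i)) (fun j => ∑ x, lineVec d₀ φ x * c (π x) (π j)) := by
    intro π d₀ hπ
    have hid' := noise_identity_letterPerm π N Xn d₀ (by rw [hπ]; exact hid)
    exact q_eq_r_of_noise N (fun t => letterPerm π (Xn t)) (fun x z => b (π x) (π z)) (fun y w => b' (π y) (π w))
      (fun x w => c (π x) (π w)) (fun y z => c' (π y) (π z)) (hsum_letterPerm π N Xn b b' c c' hsum) d₀ hid'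
  rcases d with i | ⟨i, j⟩
  · exact (e3_star _ _ _ _ (key (Equiv.swap 0 i) (Sum.inl 0) (by simp [permDescr]))).elim
  · have hij : i ≠ j := hdvalid (i, j) rfl
    obtain ⟨π, h0, h1⟩ := exists_perm_zero_one i j hij
    have hπ : permDescr π (Sum.inr (0, 1)) = Sum.inr (i, j) := by simp [permDescr, h0, h1]
    exact ⟨π, e3_matching _ _ _ _ (key π (Sum.inr (0, 1)) hπ),
      noise_identity_letterPerm π N Xn (Sum.inr (0, 1)) (by rw [hπ]; exact hid)⟩

/-! ### §2 Three matrices in a plane -/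

/-- Three matrices in a subspace of dimension `≤ 2` are linearly dependent. -/
theorem three_dep (W : Submodule ℂ (Matrix (Fin 4) (Fin 4) ℂ)) (hW : finrank ℂ W ≤ 2)
    (A B C : Matrix (Fin 4) (Fin 4) ℂ) (hA : A ∈ W) (hB : B ∈ W) (hC : C ∈ W) :
    ∃ x y z : ℂ, x • A + y • B + z • C = 0 ∧ ¬(x = 0 ∧ y = 0 ∧ z = 0) := by
  have hli : ¬ LinearIndependent ℂ (![⟨A, hA⟩, ⟨B, hB⟩, ⟨C, hC⟩] : Fin 3 → W) := by
    intro h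
    have := h.fintype_card_le_finrank
    simp only [Fintype.card_fin] at this
    omega
  rw [Fintype.not_linearIndependent_iff] at hli
  obtain ⟨g, hg, i, hi⟩ := hli
  refine ⟨g 0, g 1, g 2, ?_, ?_⟩
  · have := congrArg Subtype.val hg
    simpa [Fin.sum_univ_three] using this
  · rintro ⟨h0, h1, h2⟩
    fin_cases i <;> simp_all

/-- Entries of a vanishing combination of three matrices. -/
theorem ent3 {x y z : ℂ} {A B C : Matrix (Fin 4) (Fin 4) ℂ} (h : x • A + y • B + z • C = 0) (i j : Fin 4) :
    x * A i j + y * B i j + z * C i j = 0 := by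
  simpa using congrFun (congrFun h i) j

/-! ### §3 The planar core -/

/-- **Planar core of the profile `slice + (2,1,1)`.**  Five explicit matrices (`M = D(e₀,e₁)` and the four
`V_w = f₃D′(e₂,e_w) - f₂D′(e₃,e_w)` of the normal form) cannot lie in a plane unless `f₂ = f₃ = 0`. -/
theorem planar_core (W : Submodule ℂ (Matrix (Fin 4) (Fin 4) ℂ)) (hW : finrank ℂ W ≤ 2)
    (l β γ l' σ τ f₂ f₃ : ℂ) (U U' : Fin 4 → ℂ) (r3 : l * β + l' * γ = 0) (hf : ¬(f₂ = 0 ∧ f₃ = 0))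
    (hM : !![0, -(γ * l'), 0, 0; -(l * β), 0, 0, 0; 0, 0, 0, 1; 0, 0, 1, 0] ∈ W)
    (hV0 : !![0, β * U 0, 0, 0; γ * U' 0, β * U 1 + γ * U' 1, -f₂ + γ * U' 2, f₃ + γ * U' 3;
      0, -f₂ + β * U 2, 0, 0; 0, f₃ + β * U 3, 0, 0] ∈ W)
    (hV1 : !![-(β * U 0) - γ * U' 0, -(γ * U' 1), -f₂ - γ * U' 2, f₃ - γ * U' 3; -(β * U 1), 0, 0, 0;
      -f₂ - β * U 2, 0, 0, 0; f₃ - β * U 3, 0, 0, 0] ∈ W)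
    (hV2 : !![0, -f₂, 0, -(σ * U 0); -f₂, 0, 0, -(σ * U 1); 0, 0, 0, -(σ * U 2);
      -(τ * U' 0), -(τ * U' 1), -(τ * U' 2), -(σ * U 3) - τ * U' 3] ∈ W)
    (hV3 : !![0, f₃, -(σ * U 0), 0; f₃, 0, -(σ * U 1), 0; -(τ * U' 0), -(τ * U' 1), -(σ * U 2) - τ * U' 2, -(τ * U' 3);
      0, 0, -(σ * U 3), 0] ∈ W) : False := by
  obtain ⟨x, y, z, h1, hne1⟩ := three_dep W hW _ _ _ hM hV0 hV1
  have e23 := ent3 h1 2 3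
  have e31 := ent3 h1 3 1
  have e13 := ent3 h1 1 3
  have e21 := ent3 h1 2 1
  have e12 := ent3 h1 1 2
  have e30 := ent3 h1 3 0
  have e03 := ent3 h1 0 3
  have e20 := ent3 h1 2 0
  have e02 := ent3 h1 0 2
  have e01 := ent3 h1 0 1
  have e10 := ent3 h1 1 0
  simp [-mul_eq_zero] at e23 e31 e13 e21 e12 e30 e03 e20 e02 e01 e10
  have hx : x = 0 := by linear_combination e23
  subst hx
  by_cases hy : y = 0
  · subst hy
    have hz : z ≠ 0 := fun hz => hne1 ⟨rfl, rfl, hz⟩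
    have a1 : f₃ - β * U 3 = 0 :=
      (mul_eq_zero.1 (by linear_combination e30 : z * (f₃ - β * U 3) = 0)).resolve_left hz
    have a2 : f₃ - γ * U' 3 = 0 :=
      (mul_eq_zero.1 (by linear_combination e03 : z * (f₃ - γ * U' 3) = 0)).resolve_left hz
    have a3 : f₂ + β * U 2 = 0 :=
      (mul_eq_zero.1 (by linear_combination -e20 : z * (f₂ + β * U 2) = 0)).resolve_left hz
    have a4 : f₂ + γ * U' 2 = 0 :=
      (mul_eq_zero.1 (by linear_combination -e02 : z * (f₂ + γ * U' 2) = 0)).resolve_left hz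
    have a5 : γ * U' 1 = 0 := (mul_eq_zero.1 (by linear_combination -e01 : z * (γ * U' 1) = 0)).resolve_left hz
    have a6 : β * U 1 = 0 := (mul_eq_zero.1 (by linear_combination -e10 : z * (β * U 1) = 0)).resolve_left hz
    have hβ : β ≠ 0 := fun h0 => hf ⟨by linear_combination a3 - U 2 * h0, by linear_combination a1 + U 3 * h0⟩
    have hγ : γ ≠ 0 := fun h0 => hf ⟨by linear_combination a4 - U' 2 * h0, by linear_combination a2 + U' 3 * h0⟩
    have hU1 : U 1 = 0 := (mul_eq_zero.1 a6).resolve_left hβ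
    have hU'1 : U' 1 = 0 := (mul_eq_zero.1 a5).resolve_left hγ
    have hf3 : f₃ = 0 := by
      obtain ⟨x', y', z', h2, hne2⟩ := three_dep W hW _ _ _ hM hV0 hV3
      have d13 := ent3 h2 1 3
      have d12 := ent3 h2 1 2
      have d23 := ent3 h2 2 3
      have d01 := ent3 h2 0 1
      have d10 := ent3 h2 1 0
      simp [-mul_eq_zero] at d13 d12 d23 d01 d10
      have hy' : y' = 0 := by
        by_contra h
        refine hf ⟨?_, ?_⟩
        · have : y' * f₂ = 0 := by linear_combination (-d12 + y' * a4 - z' * σ * hU1) / 2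
          exact (mul_eq_zero.1 this).resolve_left h
        · have : y' * f₃ = 0 := by linear_combination (d13 + y' * a2) / 2
          exact (mul_eq_zero.1 this).resolve_left h
      subst hy'
      have hz' : z' ≠ 0 := fun hz' => hne2 ⟨by rw [hz'] at d23; linear_combination d23, rfl, hz'⟩
      have : z' * f₃ = 0 := by linear_combination (d01 + d10 + x' * r3) / 2
      exact (mul_eq_zero.1 this).resolve_left hz'
    have hf2 : f₂ = 0 := by
      obtain ⟨x', y', z', h2, hne2⟩ := three_dep W hW _ _ _ hM hV0 hV2
      have d13 := ent3 h2 1 3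
      have d12 := ent3 h2 1 2
      have d23 := ent3 h2 2 3
      have d01 := ent3 h2 0 1
      have d10 := ent3 h2 1 0
      simp [-mul_eq_zero] at d13 d12 d23 d01 d10
      have hy' : y' = 0 := by
        by_contra h
        refine hf ⟨?_, ?_⟩
        · have : y' * f₂ = 0 := by linear_combination (-d12 + y' * a4) / 2
          exact (mul_eq_zero.1 this).resolve_left h
        · have : y' * f₃ = 0 := by linear_combination (d13 + y' * a2 + z' * σ * hU1) / 2
          exact (mul_eq_zero.1 this).resolve_left h
      subst hy'
      have hz' : z' ≠ 0 := fun hz' => hne2 ⟨by rw [hz'] at d23; linear_combination d23, rfl, hz'⟩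
      have : z' * f₂ = 0 := by linear_combination -(d01 + d10 + x' * r3) / 2
      exact (mul_eq_zero.1 this).resolve_left hz'
    exact hf ⟨hf2, hf3⟩
  · by_cases hz : z = 0
    · subst hz
      have b1 : f₃ + β * U 3 = 0 :=
        (mul_eq_zero.1 (by linear_combination e31 : y * (f₃ + β * U 3) = 0)).resolve_left hy
      have b2 : f₃ + γ * U' 3 = 0 :=
        (mul_eq_zero.1 (by linear_combination e13 : y * (f₃ + γ * U' 3) = 0)).resolve_left hy
      have b3 : f₂ - β * U 2 = 0 :=
        (mul_eq_zero.1 (by linear_combination -e21 : y * (f₂ - β * U 2) = 0)).resolve_left hy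
      have b4 : f₂ - γ * U' 2 = 0 :=
        (mul_eq_zero.1 (by linear_combination -e12 : y * (f₂ - γ * U' 2) = 0)).resolve_left hy
      have b5 : β * U 0 = 0 := (mul_eq_zero.1 (by linear_combination e01 : y * (β * U 0) = 0)).resolve_left hy
      have b6 : γ * U' 0 = 0 := (mul_eq_zero.1 (by linear_combination e10 : y * (γ * U' 0) = 0)).resolve_left hy
      have hβ : β ≠ 0 := fun h0 => hf ⟨by linear_combination b3 + U 2 * h0, by linear_combination b1 - U 3 * h0⟩
      have hγ : γ ≠ 0 := fun h0 => hf ⟨by linear_combination b4 + U' 2 * h0, by linear_combination b2 - U' 3 * h0⟩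
      have hU0 : U 0 = 0 := (mul_eq_zero.1 b5).resolve_left hβ
      have hU'0 : U' 0 = 0 := (mul_eq_zero.1 b6).resolve_left hγ
      have hf3 : f₃ = 0 := by
        obtain ⟨x', y', z', h2, hne2⟩ := three_dep W hW _ _ _ hM hV1 hV3
        have d03 := ent3 h2 0 3
        have d02 := ent3 h2 0 2
        have d23 := ent3 h2 2 3
        have d01 := ent3 h2 0 1
        have d10 := ent3 h2 1 0
        simp [-mul_eq_zero] at d03 d02 d23 d01 d10
        have hy' : y' = 0 := by
          by_contra h
          refine hf ⟨?_, ?_⟩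
          · have : y' * f₂ = 0 := by linear_combination (-d02 + y' * b4 - z' * σ * hU0) / 2
            exact (mul_eq_zero.1 this).resolve_left h
          · have : y' * f₃ = 0 := by linear_combination (d03 + y' * b2) / 2
            exact (mul_eq_zero.1 this).resolve_left h
        subst hy'
        have hz' : z' ≠ 0 := fun hz' => hne2 ⟨by rw [hz'] at d23; linear_combination d23, rfl, hz'⟩
        have : z' * f₃ = 0 := by linear_combination (d01 + d10 + x' * r3) / 2
        exact (mul_eq_zero.1 this).resolve_left hz'
      have hf2 : f₂ = 0 := by
        obtain ⟨x', y', z', h2, hne2⟩ := three_dep W hW _ _ _ hM hV1 hV2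
        have d03 := ent3 h2 0 3
        have d02 := ent3 h2 0 2
        have d23 := ent3 h2 2 3
        have d01 := ent3 h2 0 1
        have d10 := ent3 h2 1 0
        simp [-mul_eq_zero] at d03 d02 d23 d01 d10
        have hy' : y' = 0 := by
          by_contra h
          refine hf ⟨?_, ?_⟩
          · have : y' * f₂ = 0 := by linear_combination (-d02 + y' * b4) / 2
            exact (mul_eq_zero.1 this).resolve_left h
          · have : y' * f₃ = 0 := by linear_combination (d03 + y' * b2 + z' * σ * hU0) / 2
            exact (mul_eq_zero.1 this).resolve_left h
        subst hy'
        have hz' : z' ≠ 0 := fun hz' => hne2 ⟨by rw [hz'] at d23; linear_combination d23, rfl, hz'⟩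
        have : z' * f₂ = 0 := by linear_combination -(d01 + d10 + x' * r3) / 2
        exact (mul_eq_zero.1 this).resolve_left hz'
      exact hf ⟨hf2, hf3⟩
    · have c1 : f₃ + β * U 3 = 0 :=
        (mul_eq_zero.1 (by linear_combination e31 : y * (f₃ + β * U 3) = 0)).resolve_left hy
      have c2 : f₃ - β * U 3 = 0 :=
        (mul_eq_zero.1 (by linear_combination e30 : z * (f₃ - β * U 3) = 0)).resolve_left hz
      have c3 : f₂ - β * U 2 = 0 :=
        (mul_eq_zero.1 (by linear_combination -e21 : y * (f₂ - β * U 2) = 0)).resolve_left hy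
      have c4 : f₂ + β * U 2 = 0 :=
        (mul_eq_zero.1 (by linear_combination -e20 : z * (f₂ + β * U 2) = 0)).resolve_left hz
      exact hf ⟨by linear_combination (c3 + c4) / 2, by linear_combination (c1 + c2) / 2⟩

end LaplaceFourLine

end Summit.ValiantsHypothesis.ValiantsHypothesis.Theorems.RigidityForcesSymmetryRankRigidMinimalRepr
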